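import Literature.Topology.FourManifolds.MMSWMultiIndexStripReduction
import Literature.Topology.FourManifolds.RasmussenConcordanceProofs
import HarnessLib

/-!
# `eventually_approxHasRasmussen_multiIndex` from the diagonal fact and the generalized crossing change inequality

Third sibling proof file of `Literature/Topology/FourManifolds/MMSWBeltTwistInvariance.lean`
(after `MMSWBeltTwistInvarianceProofs.lean` and `MMSWMultiIndexStripReduction.lean`), working
towards its named fact `Literature.Topology.FourManifolds.eventually_approxHasRasmussen_multiIndex`
(C. Manolescu, M. Marengon, S. Sarkar, M. Willis, *A generalization of Rasmussen's invariant, with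
applications to surfaces in some four-manifolds*, Duke Math. J. 172 (2023) 231–311,
arXiv:1910.08195, Thm. 3.7 with Thm. 3.3): for a null-homologous core-missing model knot
`K ⊂ M_r` and `ε ∈ ℤʳ`, the Rasmussen invariants of `D(k⃗)(τ^ε ∘ K) = D(k⃗ + ε)(K)` and `D(k⃗)(K)`
agree for all large `k` (`τ^ε = MMSW.beltTwist r ε`, the product of the `ε_j`-th powers of the Dehn
twists along the `r` belt spheres).

## A second road: monotonicity instead of multi-index stabilisation

The two earlier files reduce the fact to the MULTI-INDEX stabilisation of the Rasmussen
invariants of the twisted pictures ([MMSW] Thm. 3.3 for all `k⃗ ∈ ℤʳ` large, whose printed proof is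
Willis's stabilisation of the Khovanov complexes, [MMSW] Thm. 2.1, Cor. 2.2, Thm. 2.5, Thm. 2.10 —
absent from the tree), plus the single-valuedness of `s` in `S³`.  This file records a different
decomposition, in which the only stabilisation needed is the DIAGONAL one — the tree's named fact
`MMSW.eventually_approxHasRasmussen` ([MMSW] Thm. 1.4) as it stands — and the cross-index input is
an INEQUALITY:

* **(GCC)** *adding one more right-handed full twist through one handle does not increase the
  Rasmussen invariant of the picture*: `s(D(0⃗)(σ_j ∘ K)) ≤ s(D(0⃗)(K))` for every null-homologous
  core-missing model knot `K ⊂ M_r` and every handle `j` (`σ_j = τ^{e_j}`).  This is [MMSW]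
  **Thm. 1.11** (= Thm. 7.10; the generalized crossing change inequality of Cochran–Tweedy type:
  "Suppose that a link `L⁻ ⊂ S³` is obtained from `L` by adding a generalized negative crossing" —
  a positive full twist on `2p` strands, `p` up and `p` down, along a disc — "Then
  `s(L⁻) ≤ s(L)`") applied to the `S³`-knot `D(0⃗)(K)` along the spanning disc of the `j`-th dotted
  circle, which the knot crosses in `p_j` ascending and `p_j` descending points because `K` is
  null-homologous (winding number `0` about `c_j`); [MMSW] make exactly this application in the
  proof of Prop. 8.2 (iii) ("there is a null-homologous cobordism in `#^{kr} \overline{CP}²` from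
  `D(0⃗)` to `D(k⃗)`, consisting of `|L|` disjoint cylinders", Rem. 6.1).  It is taken here as the
  HYPOTHESIS `hA` (never as a named fact, D-0026); the tree has neither [MMSW] Thm. 1.11 nor the
  twist-along-a-disc operation on `S³`-knots it is about.

**The sandwich.**  Write `s(κ)` for the Rasmussen invariant of `D(κ)(K) = D(0⃗)(τ^κ ∘ K)`,
`κ ∈ ℤʳ` (single-valued by Rasmussen's theorem, hypothesis `hS`; it exists for every `κ`,
`IsModelKnot.exists_approxHasRasmussen`).  By (GCC) applied to the knots `τ^κ ∘ K` — again
null-homologous core-missing model knots — `κ ↦ s(κ)` is antitone for the componentwise order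
(`le_of_approxHasRasmussen_beltTwist_of_le`).  If `s(k, …, k) = s₀` for all `k ≥ k₀` (the diagonal
fact) and `κ_j ≥ k₀` for all `j`, then `(k₀, …, k₀) ≤ κ ≤ (M, …, M)` with `M = k₀ + Σ_j (κ_j - k₀)`,
so `s₀ = s(M, …, M) ≤ s(κ) ≤ s(k₀, …, k₀) = s₀`: **the multi-index stability of [MMSW] Thm. 3.3
follows from the diagonal one** (`approxHasRasmussen_beltTwist_of_forall_le`), and with it the named
fact, for `k ≥ k₀ + Σ_j |ε_j|` (`eventually_approxHasRasmussen_multiIndex_of_antitone`).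

**Single-valuedness of `s` in `S³`.**  The hypothesis `hS` is supplied by the tree's named fact
`HasRasmussenInvariant.eq_of_isConcordant` (Rasmussen (2010), Thm. 1: `s` is a concordance
invariant; `HasRasmussenInvariant.unique_of_eq_of_isConcordant`, `RasmussenConcordanceProofs.lean`)
— `eventually_approxHasRasmussen_multiIndex_of_eq_of_isConcordant_of_antitone` — rather than by
`Knot.reidemeister`, whose move set is flagged in `GaussDiagramsRMoves.lean`; the last section
records the same substitution for the strip reductions of `MMSWMultiIndexStripReduction.lean`.

So, over PROVED results, the named fact follows from three published theorems, two of which are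
named facts of the tree:
`HasRasmussenInvariant.eq_of_isConcordant` (Rasmussen (2010), Thm. 1),
`MMSW.eventually_approxHasRasmussen` ([MMSW] Thm. 1.4) and [MMSW] Thm. 1.11 for the pictures
(hypothesis `hA`).  Everything here is proved; no definitions, no named facts.

**Eventual antitonicity suffices (appended).**  The last section weakens the cross-index input
to EVENTUAL antitonicity in one index along the diagonal — for every admissible `K` and handle `j`,
`s(D(k⃗ + e_j)(K)) ≤ s(D(k⃗)(K))` for all large `k` (hypothesis `hAev`; implied by `hA`, and a
one-sided statement in the stable range of the twisted pictures) — using the diagonal fact for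
all the knots `τ^ε ∘ K`: the eventual values `s_ε(K)` of `k ↦ s(D(k⃗)(τ^ε ∘ K))` satisfy
`s_{ε + c·1⃗} = s_ε` and `s_{ε + e_j} ≤ s_ε`, whence
`s_0 ≥ s_{e_j} = s_{e_j - 1⃗} ≥ s_0` (lower the other `r - 1` indices one at a time), which is the
single-index re-indexing hypothesis of `eventually_approxHasRasmussen_multiIndex_of_single`
(`eventually_approxHasRasmussen_multiIndex_of_eventually_antitone`).  [MMSW] Thm. 1.11 is printed
via Thm. 1.8 (adjunction in `#ᵗ \overline{CP}²`), i.e. via Thm. 1.5 and Thm. 1.7; the eventual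
form is what either road has to supply.

## References

* C. Manolescu, M. Marengon, S. Sarkar, M. Willis, Duke Math. J. 172 (2023) 231–311,
  arXiv:1910.08195: Thm. 1.4 (= Thm. 3.3), Thm. 1.11 (= Thm. 7.10), Rem. 6.1, Thm. 3.7,
  Prop. 8.2 (i), (iii) and its proof, Prop. 8.8. [ManolescuMarengonSarkarWillis2023]
* J. Rasmussen, *Khovanov homology and the slice genus*, Invent. Math. 182 (2010) 419–447, Thm. 1.
  [Rasmussen2010]
-/

open scoped Manifold ContDiff Topology
open Function Set

noncomputable section

namespace Literature.Topology.FourManifolds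

namespace MMSW

open Literature.AlgebraicTopology.Homotopy.HopfFibration (zC wC)

variable {r : ℕ}

/-! ## Single-valuedness of `s` in `S³` from concordance invariance; levels as belt twists -/

/-- **Two Rasmussen invariants of the same finite approximation agree**, given the named fact
`HasRasmussenInvariant.eq_of_isConcordant` (Rasmussen (2010), Thm. 1: `s` is a concordance
invariant, in particular single-valued — `HasRasmussenInvariant.unique_of_eq_of_isConcordant`).
[cite: Rasmussen2010, Thm. 1] -/
theorem ApproxHasRasmussen.unique_of_eq_of_isConcordant
    (hci : HasRasmussenInvariant.eq_of_isConcordant)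
    {K : Metric.sphere (0 : EuclideanSpace ℝ (Fin 2)) 1 → EuclideanSpace ℝ (Fin 4)} {k s s' : ℤ}
    (h : ApproxHasRasmussen r k K s) (h' : ApproxHasRasmussen r k K s') : s = s' :=
  h.unique_of_hasRasmussenInvariant_unique
    (fun h₁ h₂ ↦ HasRasmussenInvariant.unique_of_eq_of_isConcordant hci h₁ h₂) h'

/-- `D(k⃗)(K) = D(0⃗)(τ^{(k,…,k)} ∘ K)`: every level of the diagonal finite approximation is the
level-`0` picture of a belt-twisted knot. [cite: ManolescuMarengonSarkarWillis2023, Thm. 2.8 (proof)] -/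
theorem approxHasRasmussen_iff_beltTwist_const_zero
    {K : Metric.sphere (0 : EuclideanSpace ℝ (Fin 2)) 1 → EuclideanSpace ℝ (Fin 4)}
    (hK : ∀ t, K t ∈ modelBoundary r) (k s : ℤ) :
    ApproxHasRasmussen r k K s ↔ ApproxHasRasmussen r 0 (beltTwist r (fun _ ↦ k) ∘ K) s := by
  rw [approxHasRasmussen_beltTwist_const_comp_iff hK k 0 s, add_zero]

/-! ## The sandwich: multi-index stability from diagonal stability and monotonicity -/

section Antitone

variable
  (hS : ∀ {K₃ : Knot} {s s' : ℤ}, K₃.HasRasmussenInvariant s → K₃.HasRasmussenInvariant s' → s = s')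
  (hA : ∀ {r : ℕ}
    {K : Metric.sphere (0 : EuclideanSpace ℝ (Fin 2)) 1 → EuclideanSpace ℝ (Fin 4)}
    (j : Fin r), IsModelKnot r K → IsNullHomologous r K →
    (∀ t, wC (K t) ≠ 0) → ∀ {s s' : ℤ},
      ApproxHasRasmussen r 0 (beltTwist r (Pi.single j 1) ∘ K) s → ApproxHasRasmussen r 0 K s' →
        s ≤ s')

include hA in
/-- **One step of the generalized crossing change inequality at a multi-index**: under `hA`
([MMSW] Thm. 1.11 for the pictures), `s(D(κ + e_j)(K)) ≤ s(D(κ)(K))` — apply `hA` to the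
null-homologous core-missing model knot `τ^κ ∘ K`, as `τ^{e_j} ∘ τ^κ ∘ K = τ^{κ + e_j} ∘ K`.
[cite: ManolescuMarengonSarkarWillis2023, Thm. 1.11 and proof of Prop. 8.2 (iii)] -/
theorem le_of_approxHasRasmussen_beltTwist_add_single
    {K : Metric.sphere (0 : EuclideanSpace ℝ (Fin 2)) 1 → EuclideanSpace ℝ (Fin 4)}
    (hK : IsModelKnot r K)
    (h0 : IsNullHomologous r K) (hw : ∀ t, wC (K t) ≠ 0) (κ : Fin r → ℤ) (j : Fin r) {s s' : ℤ}
    (hs : ApproxHasRasmussen r 0 (beltTwist r (κ + Pi.single j 1) ∘ K) s)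
    (hs' : ApproxHasRasmussen r 0 (beltTwist r κ ∘ K) s') : s ≤ s' := by
  rw [← beltTwist_comp_beltTwist_comp hK.mem κ (Pi.single j 1)] at hs
  exact hA j (hK.beltTwist_comp κ) ((isNullHomologous_beltTwist_comp_iff K κ).2 h0)
    (wC_beltTwist_comp_ne_zero hK hw κ) hs hs'

include hS hA in
/-- **`κ ↦ s(D(κ)(K))` is antitone for the componentwise order on `ℤʳ`** (given single-valuedness
of `s` in `S³` and [MMSW] Thm. 1.11 for the pictures): go from `κ` to `κ' ≥ κ` one right-handed
full twist at a time, through the pictures `D(κ'')(K)`, each of which has a Rasmussen invariant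
(`IsModelKnot.exists_approxHasRasmussen`); induction on `Σ_j (κ'_j - κ_j)`.
[cite: ManolescuMarengonSarkarWillis2023, Thm. 1.11 and proof of Prop. 8.2 (iii)] -/
theorem le_of_approxHasRasmussen_beltTwist_of_le
    {K : Metric.sphere (0 : EuclideanSpace ℝ (Fin 2)) 1 → EuclideanSpace ℝ (Fin 4)}
    (hK : IsModelKnot r K)
    (h0 : IsNullHomologous r K) (hw : ∀ t, wC (K t) ≠ 0) {κ κ' : Fin r → ℤ} (hle : κ ≤ κ')
    {s s' : ℤ} (hs' : ApproxHasRasmussen r 0 (beltTwist r κ' ∘ K) s')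
    (hs : ApproxHasRasmussen r 0 (beltTwist r κ ∘ K) s) : s' ≤ s := by
  -- induction on the total increment `Σ_j (κ'_j - κ_j)`
  suffices H : ∀ n : ℕ, ∀ κ' : Fin r → ℤ, κ ≤ κ' → ∑ j, (κ' j - κ j) = n → ∀ s' : ℤ,
      ApproxHasRasmussen r 0 (beltTwist r κ' ∘ K) s' → s' ≤ s by
    have hnn : 0 ≤ ∑ j, (κ' j - κ j) := Finset.sum_nonneg fun j _ ↦ sub_nonneg.2 (hle j)
    exact H (∑ j, (κ' j - κ j)).toNat κ' hle (Int.toNat_of_nonneg hnn).symm s' hs'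
  intro n
  induction n with
  | zero =>
    intro κ' hle hsum s' hs'
    have heq : κ' = κ := by
      funext j
      have h1 : ∀ i ∈ (Finset.univ : Finset (Fin r)), 0 ≤ κ' i - κ i :=
        fun i _ ↦ sub_nonneg.2 (hle i)
      have h2 := (Finset.sum_eq_zero_iff_of_nonneg h1).1 (by exact_mod_cast hsum) j
        (Finset.mem_univ j)
      linarith
    subst heq
    exact (hs'.unique_of_hasRasmussenInvariant_unique hS hs).le
  | succ n ih =>
    intro κ' hle hsum s' hs'
    -- some coordinate is incremented: peel off one full twist there
    have hpos : ∑ _i : Fin r, (0 : ℤ) < ∑ i : Fin r, (κ' i - κ i) := by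
      rw [Finset.sum_const_zero, hsum]
      exact_mod_cast Nat.succ_pos n
    obtain ⟨j, -, hj⟩ := Finset.exists_lt_of_sum_lt hpos
    have hle'' : κ ≤ κ' - Pi.single j 1 := fun i ↦ by
      rcases eq_or_ne i j with rfl | hij
      · simp only [Pi.sub_apply, Pi.single_eq_same]
        linarith
      · simp only [Pi.sub_apply, Pi.single_eq_of_ne hij, sub_zero]
        exact hle i
    have hsum'' : ∑ i, ((κ' - Pi.single j 1 : Fin r → ℤ) i - κ i) = n := by
      have h1 : ∀ i, (κ' - Pi.single j 1 : Fin r → ℤ) i - κ i =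
          (κ' i - κ i) - (Pi.single j (1 : ℤ) : Fin r → ℤ) i :=
        fun i ↦ by simp only [Pi.sub_apply]; ring
      simp_rw [h1]
      rw [Finset.sum_sub_distrib, hsum, Finset.sum_pi_single']
      simp
    obtain ⟨s'', hs''⟩ := (hK.beltTwist_comp (κ' - Pi.single j 1)).exists_approxHasRasmussen
      (wC_beltTwist_comp_ne_zero hK hw _) 0
    have h1 : s' ≤ s'' := by
      refine le_of_approxHasRasmussen_beltTwist_add_single hA hK h0 hw (κ' - Pi.single j 1) j ?_ hs''
      rwa [sub_add_cancel]
    exact h1.trans (ih (κ' - Pi.single j 1) hle'' hsum'' s'' hs'')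

include hS hA in
/-- **The diagonal sequence `k ↦ s(D(k⃗)(K))` is antitone** (the case of constant multi-indices;
cf. [MMSW] Prop. 8.2 (iii): `s₋(L) ≤ s(D(0⃗))`). [cite: ManolescuMarengonSarkarWillis2023, Prop. 8.2 (iii)] -/
theorem le_of_approxHasRasmussen_of_le
    {K : Metric.sphere (0 : EuclideanSpace ℝ (Fin 2)) 1 → EuclideanSpace ℝ (Fin 4)}
    (hK : IsModelKnot r K)
    (h0 : IsNullHomologous r K) (hw : ∀ t, wC (K t) ≠ 0) {k k' : ℤ} (hkk : k ≤ k') {s s' : ℤ}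
    (hs' : ApproxHasRasmussen r k' K s') (hs : ApproxHasRasmussen r k K s) : s' ≤ s := by
  rw [approxHasRasmussen_iff_beltTwist_const_zero hK.mem] at hs hs'
  exact le_of_approxHasRasmussen_beltTwist_of_le hS hA hK h0 hw (fun _ ↦ hkk) hs' hs

include hS hA in
/-- **Multi-index stability from diagonal stability (the sandwich).**  If `s(D(k⃗)(K)) = s₀` for
all `k ≥ k₀`, then `s(D(κ)(K)) = s₀` for every multi-index `κ` with `κ_j ≥ k₀` for all `j`:
`(k₀,…,k₀) ≤ κ ≤ (M,…,M)` with `M = k₀ + Σ_j (κ_j - k₀)`, so by antitonicity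
`s₀ = s(D(M⃗)) ≤ s(D(κ)) ≤ s(D(k₀⃗)) = s₀`.  This is [MMSW] Thm. 3.3 in multi-index form, obtained
from its diagonal case and Thm. 1.11 instead of the multi-index stabilisation of the Khovanov
complexes. [cite: ManolescuMarengonSarkarWillis2023, Thm. 3.3, Thm. 1.11 and Prop. 8.2] -/
theorem approxHasRasmussen_beltTwist_of_forall_le
    {K : Metric.sphere (0 : EuclideanSpace ℝ (Fin 2)) 1 → EuclideanSpace ℝ (Fin 4)}
    (hK : IsModelKnot r K)
    (h0 : IsNullHomologous r K) (hw : ∀ t, wC (K t) ≠ 0) {s₀ k₀ : ℤ}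
    (hk : ∀ k : ℤ, k₀ ≤ k → ApproxHasRasmussen r k K s₀) {κ : Fin r → ℤ} (hκ : ∀ j, k₀ ≤ κ j) :
    ApproxHasRasmussen r 0 (beltTwist r κ ∘ K) s₀ := by
  -- the upper corner `M⃗ ≥ κ`
  have hnn : 0 ≤ ∑ j, (κ j - k₀) := Finset.sum_nonneg fun j _ ↦ sub_nonneg.2 (hκ j)
  have hκM : κ ≤ fun _ ↦ k₀ + ∑ j, (κ j - k₀) := fun j ↦ by
    have : κ j - k₀ ≤ ∑ i, (κ i - k₀) :=
      Finset.single_le_sum (f := fun i ↦ κ i - k₀) (fun i _ ↦ sub_nonneg.2 (hκ i))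
        (Finset.mem_univ j)
    show κ j ≤ k₀ + ∑ i, (κ i - k₀)
    linarith
  have hκm : (fun _ ↦ k₀ : Fin r → ℤ) ≤ κ := fun j ↦ hκ j
  have hlow : ApproxHasRasmussen r 0 (beltTwist r (fun _ ↦ k₀) ∘ K) s₀ :=
    (approxHasRasmussen_iff_beltTwist_const_zero hK.mem k₀ s₀).1 (hk k₀ le_rfl)
  have hup : ApproxHasRasmussen r 0 (beltTwist r (fun _ ↦ k₀ + ∑ j, (κ j - k₀)) ∘ K) s₀ :=
    (approxHasRasmussen_iff_beltTwist_const_zero hK.mem _ s₀).1 (hk _ (by linarith))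
  obtain ⟨s, hs⟩ :=
    (hK.beltTwist_comp κ).exists_approxHasRasmussen (wC_beltTwist_comp_ne_zero hK hw κ) 0
  have h1 : s₀ ≤ s := le_of_approxHasRasmussen_beltTwist_of_le hS hA hK h0 hw hκM hup hs
  have h2 : s ≤ s₀ := le_of_approxHasRasmussen_beltTwist_of_le hS hA hK h0 hw hκm hs hlow
  obtain rfl : s = s₀ := le_antisymm h2 h1
  exact hs

include hS hA in
/-- **[MMSW] Thm. 3.3 in multi-index form, from the diagonal fact and Thm. 1.11**: for a
null-homologous core-missing model knot there are `s₀` and `k₀` with `s(D(κ)(K)) = s₀` for all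
`κ ≥ (k₀, …, k₀)`. [cite: ManolescuMarengonSarkarWillis2023, Thm. 3.3 and Thm. 1.11] -/
theorem exists_forall_approxHasRasmussen_beltTwist_of_antitone (hev : eventually_approxHasRasmussen)
    {K : Metric.sphere (0 : EuclideanSpace ℝ (Fin 2)) 1 → EuclideanSpace ℝ (Fin 4)}
    (hK : IsModelKnot r K) (h0 : IsNullHomologous r K) (hw : ∀ t, wC (K t) ≠ 0) :
    ∃ s₀ k₀ : ℤ, ∀ κ : Fin r → ℤ, (∀ j, k₀ ≤ κ j) →
      ApproxHasRasmussen r 0 (beltTwist r κ ∘ K) s₀ := by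
  obtain ⟨s₀, k₀, hk⟩ := hev hK h0 hw
  exact ⟨s₀, k₀, fun κ hκ ↦ approxHasRasmussen_beltTwist_of_forall_le hS hA hK h0 hw hk hκ⟩

include hS hA in
/-- **The conclusion of the named fact for one knot**, from diagonal stability at that knot and
monotonicity: for `k ≥ k₀ + Σ_j |ε_j|` both `k⃗ + ε` and `k⃗` are `≥ (k₀, …, k₀)`, so
`D(k⃗)(τ^ε ∘ K) = D(k⃗ + ε)(K)` and `D(k⃗)(K)` both have Rasmussen invariant `s₀`, and only `s₀`.
[cite: ManolescuMarengonSarkarWillis2023, Thm. 3.7, Thm. 3.3 and Thm. 1.11] -/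
theorem exists_forall_approxHasRasmussen_beltTwist_comp_iff_of_antitone
    {K : Metric.sphere (0 : EuclideanSpace ℝ (Fin 2)) 1 → EuclideanSpace ℝ (Fin 4)}
    (hK : IsModelKnot r K) (h0 : IsNullHomologous r K) (hw : ∀ t, wC (K t) ≠ 0) {s₀ k₀ : ℤ}
    (hk : ∀ k : ℤ, k₀ ≤ k → ApproxHasRasmussen r k K s₀) (ε : Fin r → ℤ) :
    ∃ k₁ : ℤ, ∀ k : ℤ, k₁ ≤ k → ∀ s : ℤ,
      ApproxHasRasmussen r k (beltTwist r ε ∘ K) s ↔ ApproxHasRasmussen r k K s := by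
  refine ⟨k₀ + ∑ j, |ε j|, fun k hkk s ↦ ?_⟩
  have hsum : (0 : ℤ) ≤ ∑ i, |ε i| := Finset.sum_nonneg fun i _ ↦ abs_nonneg (ε i)
  have hκ₁ : ∀ j, k₀ ≤ (ε + fun _ ↦ k : Fin r → ℤ) j := fun j ↦ by
    have h1 : |ε j| ≤ ∑ i, |ε i| :=
      Finset.single_le_sum (f := fun i ↦ |ε i|) (fun i _ ↦ abs_nonneg (ε i)) (Finset.mem_univ j)
    have h2 : -|ε j| ≤ ε j := neg_abs_le _
    simp only [Pi.add_apply]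
    linarith
  have hκ₂ : ∀ j : Fin r, k₀ ≤ (fun _ : Fin r ↦ k) j := fun j ↦ by
    show k₀ ≤ k
    linarith
  have hA' : ApproxHasRasmussen r 0 (beltTwist r (ε + fun _ ↦ k) ∘ K) s₀ :=
    approxHasRasmussen_beltTwist_of_forall_le hS hA hK h0 hw hk hκ₁
  have hB : ApproxHasRasmussen r 0 (beltTwist r (fun _ ↦ k) ∘ K) s₀ :=
    approxHasRasmussen_beltTwist_of_forall_le hS hA hK h0 hw hk hκ₂
  have hKε : IsModelKnot r (beltTwist r ε ∘ K) := hK.beltTwist_comp ε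
  rw [approxHasRasmussen_iff_beltTwist_const_zero hKε.mem k s,
    beltTwist_comp_beltTwist_comp hK.mem ε (fun _ ↦ k),
    approxHasRasmussen_iff_beltTwist_const_zero hK.mem k s]
  exact ⟨fun h ↦ by rw [h.unique_of_hasRasmussenInvariant_unique hS hA']; exact hB,
    fun h ↦ by rw [h.unique_of_hasRasmussenInvariant_unique hS hB]; exact hA'⟩

include hS hA in
/-- **Reduction of `eventually_approxHasRasmussen_multiIndex` to the diagonal fact and the
generalized crossing change inequality.**  Given single-valuedness of the Rasmussen invariant of
a knot in `S³` (hypothesis `hS`, Rasmussen (2010), Thm. 1) and [MMSW] Thm. 1.11 for the pictures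
(hypothesis `hA`: one more right-handed full twist through one handle does not increase `s` of the
picture of a null-homologous core-missing model knot), the diagonal finite approximation theorem
`MMSW.eventually_approxHasRasmussen` ([MMSW] Thm. 1.4) implies the named fact: no multi-index
stabilisation of Khovanov complexes is needed on this road.
[cite: ManolescuMarengonSarkarWillis2023, Thm. 3.7, Thm. 3.3, Thm. 1.4 and Thm. 1.11] -/
theorem eventually_approxHasRasmussen_multiIndex_of_antitone (hev : eventually_approxHasRasmussen) :
    eventually_approxHasRasmussen_multiIndex := by
  rw [eventually_approxHasRasmussen_multiIndex_iff]
  intro r K hK h0 hw ε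
  obtain ⟨s₀, k₀, hk⟩ := hev hK h0 hw
  exact exists_forall_approxHasRasmussen_beltTwist_comp_iff_of_antitone hS hA hK h0 hw hk ε

end Antitone

/-- **The named fact from three published theorems**: Rasmussen's theorem that `s` is a
concordance invariant (the tree's named fact `HasRasmussenInvariant.eq_of_isConcordant`, which
contains the single-valuedness of `s` in `S³`), the diagonal finite approximation theorem
(`MMSW.eventually_approxHasRasmussen`, [MMSW] Thm. 1.4) and the generalized crossing change
inequality [MMSW] Thm. 1.11 for the pictures (hypothesis `hA`).
[cite: ManolescuMarengonSarkarWillis2023, Thm. 3.7, Thm. 3.3, Thm. 1.4 and Thm. 1.11] -/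
theorem eventually_approxHasRasmussen_multiIndex_of_eq_of_isConcordant_of_antitone
    (hci : HasRasmussenInvariant.eq_of_isConcordant) (hev : eventually_approxHasRasmussen)
    (hA : ∀ {r : ℕ}
    {K : Metric.sphere (0 : EuclideanSpace ℝ (Fin 2)) 1 → EuclideanSpace ℝ (Fin 4)}
    (j : Fin r), IsModelKnot r K → IsNullHomologous r K →
      (∀ t, wC (K t) ≠ 0) → ∀ {s s' : ℤ},
        ApproxHasRasmussen r 0 (beltTwist r (Pi.single j 1) ∘ K) s → ApproxHasRasmussen r 0 K s' →
          s ≤ s') :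
    eventually_approxHasRasmussen_multiIndex :=
  eventually_approxHasRasmussen_multiIndex_of_antitone
    (fun h h' ↦ HasRasmussenInvariant.unique_of_eq_of_isConcordant hci h h') hA hev

/-- The same with the single-valuedness of `s` taken from the tree's Reidemeister fact
(`hasRasmussenInvariant_unique_of_reidemeister`). [cite: ManolescuMarengonSarkarWillis2023, Thm. 3.7, Thm. 3.3, Thm. 1.4 and Thm. 1.11] -/
theorem eventually_approxHasRasmussen_multiIndex_of_reidemeister_of_antitone
    (hR : Knot.reidemeister) (hev : eventually_approxHasRasmussen)
    (hA : ∀ {r : ℕ}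
    {K : Metric.sphere (0 : EuclideanSpace ℝ (Fin 2)) 1 → EuclideanSpace ℝ (Fin 4)}
    (j : Fin r), IsModelKnot r K → IsNullHomologous r K →
      (∀ t, wC (K t) ≠ 0) → ∀ {s s' : ℤ},
        ApproxHasRasmussen r 0 (beltTwist r (Pi.single j 1) ∘ K) s → ApproxHasRasmussen r 0 K s' →
          s ≤ s') :
    eventually_approxHasRasmussen_multiIndex :=
  eventually_approxHasRasmussen_multiIndex_of_antitone
    (fun h h' ↦ hasRasmussenInvariant_unique_of_reidemeister hR h h') hA hev

/-! ## The strip reductions over concordance invariance of `s`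

The robust strip reductions of `MMSWMultiIndexStripReduction.lean` take the single-valuedness of
`s` in `S³` as the hypothesis `hS`; here it is fed by the named fact
`HasRasmussenInvariant.eq_of_isConcordant` (Rasmussen (2010), Thm. 1) instead of `Knot.reidemeister`. -/

/-- **Reduction of `eventually_approxHasRasmussen_multiIndex` to multi-count strip stability and
concordance invariance of `s`** (`eventually_approxHasRasmussen_multiIndex_of_multiStripStable_of_unique`
fed by `HasRasmussenInvariant.eq_of_isConcordant`).
[cite: ManolescuMarengonSarkarWillis2023, Thm. 3.7, Thm. 3.3 and Thm. 2.8 (proof)] -/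
theorem eventually_approxHasRasmussen_multiIndex_of_multiStripStable_of_eq_of_isConcordant
    (hci : HasRasmussenInvariant.eq_of_isConcordant)
    (h : ∀ {r : ℕ}
    {K : Metric.sphere (0 : EuclideanSpace ℝ (Fin 2)) 1 → EuclideanSpace ℝ (Fin 4)}
    , 0 < r → IsModelKnot r K → IsNullHomologous r K →
      (∀ t, wC (K t) ≠ 0) →
        ∃ (w : ℝ) (e : Fin r → ℝ) (s k₀ : ℤ), 0 < w ∧ (∀ j, |e j| + w < 1) ∧
          ∀ κ : Fin r → ℤ, (∀ j, k₀ ≤ κ j) →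
            ApproxHasRasmussen r 0 (stripTwistAtMulti r κ w e ∘ K) s) :
    eventually_approxHasRasmussen_multiIndex :=
  eventually_approxHasRasmussen_multiIndex_of_multiStripStable_of_unique
    (fun h₁ h₂ ↦ HasRasmussenInvariant.unique_of_eq_of_isConcordant hci h₁ h₂) h

/-- **Reduction of `eventually_approxHasRasmussen_multiIndex` to multi-count strip stability in
general position and concordance invariance of `s`**
(`eventually_approxHasRasmussen_multiIndex_of_multiStripStable_inGeneralPosition_of_unique` fed by
`HasRasmussenInvariant.eq_of_isConcordant`).
[cite: ManolescuMarengonSarkarWillis2023, Thm. 3.7, Thm. 3.3 and §8.1] -/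
theorem eventually_approxHasRasmussen_multiIndex_of_multiStripStable_inGeneralPosition_of_eq_of_isConcordant
    (hci : HasRasmussenInvariant.eq_of_isConcordant)
    (h : ∀ {r : ℕ}
    {K : Metric.sphere (0 : EuclideanSpace ℝ (Fin 2)) 1 → EuclideanSpace ℝ (Fin 4)}
    , 0 < r → IsModelKnot r K → IsNullHomologous r K →
      (∀ t, wC (K t) ≠ 0) → (∃ K₃ : Knot, ⇑K₃ = finiteApprox r 0 K ∧ K₃.InGeneralPosition) →
        ∃ (w : ℝ) (e : Fin r → ℝ) (s k₀ : ℤ), 0 < w ∧ (∀ j, |e j| + w < 1) ∧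
          ∀ κ : Fin r → ℤ, (∀ j, k₀ ≤ κ j) →
            ApproxHasRasmussen r 0 (stripTwistAtMulti r κ w e ∘ K) s) :
    eventually_approxHasRasmussen_multiIndex :=
  eventually_approxHasRasmussen_multiIndex_of_multiStripStable_inGeneralPosition_of_unique
    (fun h₁ h₂ ↦ HasRasmussenInvariant.unique_of_eq_of_isConcordant hci h₁ h₂) h

/-! ## Eventual antitonicity in one index along the diagonal suffices

The sandwich uses [MMSW] Thm. 1.11 at level `0` for every admissible knot.  A weaker cross-index
input suffices, at the price of using the diagonal fact for all the knots `τ^ε ∘ K`: **eventual**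
antitonicity in ONE index along the diagonal (`hAev`: for every null-homologous core-missing
model knot `K ⊂ M_r` and handle `j`, `s(D(k⃗)(σ_j ∘ K)) ≤ s(D(k⃗)(K))` for all large `k`).  Write
`s_ε(K)` for the eventual value of `k ↦ s(D(k⃗)(τ^ε ∘ K))` (the diagonal fact for `τ^ε ∘ K`,
single-valued by `hS`): `s_{ε + c·1⃗} = s_ε` (the same sequence shifted, `stable_shift`),
`s_{ε + e_j} ≤ s_ε` (`hAev` for `τ^ε ∘ K`, `stable_le_of_add_single`), hence `s` is antitone in
`ε` for the componentwise order (`stable_le_of_le`) and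
`s_0 ≥ s_{e_j} = s_{e_j - 1⃗} ≥ s_0`, the multi-index `e_j - 1⃗ = -Σ_{i ≠ j} e_i` being `≤ 0`
(`stable_single_eq`). -/

section EventuallyAntitone

variable
  (hS : ∀ {K₃ : Knot} {s s' : ℤ}, K₃.HasRasmussenInvariant s → K₃.HasRasmussenInvariant s' → s = s')
  (hev : eventually_approxHasRasmussen)
  (hAev : ∀ {r : ℕ}
    {K : Metric.sphere (0 : EuclideanSpace ℝ (Fin 2)) 1 → EuclideanSpace ℝ (Fin 4)}
    (j : Fin r), IsModelKnot r K → IsNullHomologous r K → (∀ t, wC (K t) ≠ 0) →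
      ∃ k₁ : ℤ, ∀ k : ℤ, k₁ ≤ k → ∀ {s s' : ℤ},
        ApproxHasRasmussen r k (beltTwist r (Pi.single j 1) ∘ K) s →
          ApproxHasRasmussen r k K s' → s ≤ s')

include hev in
/-- The diagonal fact for the admissible knot `τ^ε ∘ K`: the eventual value `s_ε(K)` exists.
[cite: ManolescuMarengonSarkarWillis2023, Thm. 1.4] -/
theorem exists_stable_beltTwist
    {K : Metric.sphere (0 : EuclideanSpace ℝ (Fin 2)) 1 → EuclideanSpace ℝ (Fin 4)}
    (hK : IsModelKnot r K) (h0 : IsNullHomologous r K) (hw : ∀ t, wC (K t) ≠ 0)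
    (ε : Fin r → ℤ) :
    ∃ s k₀ : ℤ, ∀ k : ℤ, k₀ ≤ k → ApproxHasRasmussen r k (beltTwist r ε ∘ K) s :=
  hev (hK.beltTwist_comp ε) ((isNullHomologous_beltTwist_comp_iff K ε).2 h0)
    (wC_beltTwist_comp_ne_zero hK hw ε)

include hS in
/-- Eventual values of `k ↦ s(D(k⃗)(K'))` are unique (single-valuedness of `s` at a common level).
[cite: Rasmussen2010, Thm. 1] -/
theorem stable_unique
    {K' : Metric.sphere (0 : EuclideanSpace ℝ (Fin 2)) 1 → EuclideanSpace ℝ (Fin 4)}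
    {s s' k₀ k₀' : ℤ} (h : ∀ k : ℤ, k₀ ≤ k → ApproxHasRasmussen r k K' s)
    (h' : ∀ k : ℤ, k₀' ≤ k → ApproxHasRasmussen r k K' s') : s = s' :=
  (h (max k₀ k₀') (le_max_left _ _)).unique_of_hasRasmussenInvariant_unique hS
    (h' (max k₀ k₀') (le_max_right _ _))

/-- **`s_{ε + c·1⃗} = s_ε`**: `D(k⃗)(τ^{ε + c·1⃗} ∘ K) = D(k⃗ + c⃗)(τ^ε ∘ K)` is the same sequence of
knots, shifted by `c`. [cite: ManolescuMarengonSarkarWillis2023, Thm. 2.8 (proof)] -/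
theorem stable_shift
    {K : Metric.sphere (0 : EuclideanSpace ℝ (Fin 2)) 1 → EuclideanSpace ℝ (Fin 4)}
    (hK : ∀ t, K t ∈ modelBoundary r) (ε : Fin r → ℤ) (c : ℤ) {s k₀ : ℤ}
    (h : ∀ k : ℤ, k₀ ≤ k → ApproxHasRasmussen r k (beltTwist r (ε + fun _ ↦ c) ∘ K) s) :
    ∀ k : ℤ, k₀ + c ≤ k → ApproxHasRasmussen r k (beltTwist r ε ∘ K) s := by
  intro k hk
  have h1 := h (k - c) (by omega)
  rw [← beltTwist_comp_beltTwist_comp hK ε (fun _ ↦ c),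
    approxHasRasmussen_beltTwist_const_comp_iff (K := beltTwist r ε ∘ K)
      (fun t ↦ beltTwist_mem_modelBoundary (hK t) ε)] at h1
  have h2 : c + (k - c) = k := by ring
  rwa [h2] at h1

include hAev in
/-- **`s_{ε + e_j} ≤ s_ε`**: `hAev` applied to the null-homologous core-missing model knot
`τ^ε ∘ K`, as `τ^{e_j} ∘ τ^ε ∘ K = τ^{ε + e_j} ∘ K`. [cite: ManolescuMarengonSarkarWillis2023, Thm. 1.11 and Thm. 3.7] -/
theorem stable_le_of_add_single
    {K : Metric.sphere (0 : EuclideanSpace ℝ (Fin 2)) 1 → EuclideanSpace ℝ (Fin 4)}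
    (hK : IsModelKnot r K) (h0 : IsNullHomologous r K) (hw : ∀ t, wC (K t) ≠ 0)
    (ε : Fin r → ℤ) (j : Fin r) {s s' k₀ k₀' : ℤ}
    (h : ∀ k : ℤ, k₀ ≤ k → ApproxHasRasmussen r k (beltTwist r (ε + Pi.single j 1) ∘ K) s)
    (h' : ∀ k : ℤ, k₀' ≤ k → ApproxHasRasmussen r k (beltTwist r ε ∘ K) s') : s ≤ s' := by
  obtain ⟨k₁, hk₁⟩ := hAev j (hK.beltTwist_comp ε)
    ((isNullHomologous_beltTwist_comp_iff K ε).2 h0) (wC_beltTwist_comp_ne_zero hK hw ε)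
  have hA1 := h (max (max k₀ k₀') k₁) ((le_max_left _ _).trans (le_max_left _ _))
  rw [← beltTwist_comp_beltTwist_comp hK.mem ε (Pi.single j 1)] at hA1
  exact hk₁ _ (le_max_right _ _) hA1 (h' _ ((le_max_right _ _).trans (le_max_left _ _)))

include hS hev hAev in
/-- **`ε ↦ s_ε(K)` is antitone for the componentwise order on `ℤʳ`** (one index at a time, through
the eventual values of the intermediate knots, which exist by the diagonal fact; induction on
`Σ_j (ε'_j - ε_j)`). [cite: ManolescuMarengonSarkarWillis2023, Thm. 1.11 and Thm. 1.4] -/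
theorem stable_le_of_le
    {K : Metric.sphere (0 : EuclideanSpace ℝ (Fin 2)) 1 → EuclideanSpace ℝ (Fin 4)}
    (hK : IsModelKnot r K) (h0 : IsNullHomologous r K) (hw : ∀ t, wC (K t) ≠ 0)
    {ε ε' : Fin r → ℤ} (hle : ε ≤ ε') {s s' k₀ k₀' : ℤ}
    (h' : ∀ k : ℤ, k₀' ≤ k → ApproxHasRasmussen r k (beltTwist r ε' ∘ K) s')
    (h : ∀ k : ℤ, k₀ ≤ k → ApproxHasRasmussen r k (beltTwist r ε ∘ K) s) : s' ≤ s := by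
  -- induction on the total increment `Σ_j (ε'_j - ε_j)`
  suffices H : ∀ n : ℕ, ∀ ε' : Fin r → ℤ, ε ≤ ε' → ∑ j, (ε' j - ε j) = n → ∀ s' k₀' : ℤ,
      (∀ k : ℤ, k₀' ≤ k → ApproxHasRasmussen r k (beltTwist r ε' ∘ K) s') → s' ≤ s by
    have hnn : 0 ≤ ∑ j, (ε' j - ε j) := Finset.sum_nonneg fun j _ ↦ sub_nonneg.2 (hle j)
    exact H (∑ j, (ε' j - ε j)).toNat ε' hle (Int.toNat_of_nonneg hnn).symm s' k₀' h'
  intro n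
  induction n with
  | zero =>
    intro ε' hle hsum s' k₀' h'
    have heq : ε' = ε := by
      funext j
      have h1 : ∀ i ∈ (Finset.univ : Finset (Fin r)), 0 ≤ ε' i - ε i :=
        fun i _ ↦ sub_nonneg.2 (hle i)
      have h2 := (Finset.sum_eq_zero_iff_of_nonneg h1).1 (by exact_mod_cast hsum) j
        (Finset.mem_univ j)
      linarith
    subst heq
    exact (stable_unique hS h' h).le
  | succ n ih =>
    intro ε' hle hsum s' k₀' h'
    have hpos : ∑ _i : Fin r, (0 : ℤ) < ∑ i : Fin r, (ε' i - ε i) := by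
      rw [Finset.sum_const_zero, hsum]
      exact_mod_cast Nat.succ_pos n
    obtain ⟨j, -, hj⟩ := Finset.exists_lt_of_sum_lt hpos
    have hle'' : ε ≤ ε' - Pi.single j 1 := fun i ↦ by
      rcases eq_or_ne i j with rfl | hij
      · simp only [Pi.sub_apply, Pi.single_eq_same]
        linarith
      · simp only [Pi.sub_apply, Pi.single_eq_of_ne hij, sub_zero]
        exact hle i
    have hsum'' : ∑ i, ((ε' - Pi.single j 1 : Fin r → ℤ) i - ε i) = n := by
      have h1 : ∀ i, (ε' - Pi.single j 1 : Fin r → ℤ) i - ε i =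
          (ε' i - ε i) - (Pi.single j (1 : ℤ) : Fin r → ℤ) i :=
        fun i ↦ by simp only [Pi.sub_apply]; ring
      simp_rw [h1]
      rw [Finset.sum_sub_distrib, hsum, Finset.sum_pi_single']
      simp
    obtain ⟨s'', k₀'', hs''⟩ := exists_stable_beltTwist hev hK h0 hw (ε' - Pi.single j 1)
    have h1 : s' ≤ s'' := by
      refine stable_le_of_add_single hAev hK h0 hw (ε' - Pi.single j 1) j (k₀ := k₀') ?_ hs''
      rwa [sub_add_cancel]
    exact h1.trans (ih (ε' - Pi.single j 1) hle'' hsum'' s'' k₀'' hs'')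

include hS hev hAev in
/-- **`s_{e_j}(K) = s_0(K)`: eventually `s(D(k⃗ + e_j)(K)) = s(D(k⃗)(K))`** — the single-index
re-indexing of [MMSW]'s proof of Thm. 2.8 for `σ_j`, from the diagonal fact, single-valuedness of
`s` and eventual antitonicity: `s_{e_j} ≤ s_0` is one step of `hAev`; and
`s_{e_j} = s_{e_j - 1⃗}` (shift) with `e_j - 1⃗ ≤ 0`, so `s_{e_j} ≥ s_0` by antitonicity in the
other `r - 1` indices. [cite: ManolescuMarengonSarkarWillis2023, Thm. 2.8 (proof), Thm. 3.7 and Thm. 1.11] -/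
theorem stable_single_eq
    {K : Metric.sphere (0 : EuclideanSpace ℝ (Fin 2)) 1 → EuclideanSpace ℝ (Fin 4)}
    (hK : IsModelKnot r K) (h0 : IsNullHomologous r K) (hw : ∀ t, wC (K t) ≠ 0) (j : Fin r)
    {s₀ s₁ k₀ k₁ : ℤ} (h₀ : ∀ k : ℤ, k₀ ≤ k → ApproxHasRasmussen r k K s₀)
    (h₁ : ∀ k : ℤ, k₁ ≤ k → ApproxHasRasmussen r k (beltTwist r (Pi.single j 1) ∘ K) s₁) :
    s₁ = s₀ := by
  have h₀' : ∀ k : ℤ, k₀ ≤ k → ApproxHasRasmussen r k (beltTwist r 0 ∘ K) s₀ := by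
    rw [show beltTwist r 0 ∘ K = K from funext fun t ↦ beltTwist_zero (K t)]
    exact h₀
  refine le_antisymm ?_ ?_
  · -- `s₁ ≤ s₀`: one step at the base `0`
    refine stable_le_of_add_single hAev hK h0 hw 0 j (k₀ := k₁) ?_ h₀'
    rw [zero_add]
    exact h₁
  · -- `s₀ ≤ s₁`: shift `e_j` down the diagonal by one, then compare with `0` from below
    have h₁' : ∀ k : ℤ, k₁ + 1 ≤ k →
        ApproxHasRasmussen r k (beltTwist r (Pi.single j 1 + fun _ ↦ (-1 : ℤ)) ∘ K) s₁ := by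
      refine stable_shift hK.mem (Pi.single j 1 + fun _ ↦ (-1 : ℤ)) 1 ?_
      have : ((Pi.single j 1 + fun _ ↦ (-1 : ℤ)) + fun _ ↦ (1 : ℤ)) = Pi.single j 1 := by
        funext i
        simp only [Pi.add_apply]
        ring
      rw [this]
      exact h₁
    have hle : (Pi.single j 1 + fun _ ↦ (-1 : ℤ) : Fin r → ℤ) ≤ 0 := fun i ↦ by
      rcases eq_or_ne i j with rfl | hij
      · simp only [Pi.add_apply, Pi.single_eq_same, Pi.zero_apply]
        norm_num
      · simp only [Pi.add_apply, Pi.single_eq_of_ne hij, Pi.zero_apply]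
        norm_num
    exact stable_le_of_le hS hev hAev hK h0 hw hle h₀' h₁'

include hS hev hAev in
/-- **Reduction of `eventually_approxHasRasmussen_multiIndex` to the diagonal fact,
single-valuedness of `s` in `S³` and EVENTUAL antitonicity in one index** (hypothesis `hAev`:
for every null-homologous core-missing model knot and every handle `j`,
`s(D(k⃗)(σ_j ∘ K)) ≤ s(D(k⃗)(K))` for all large `k`): by `stable_single_eq` the single-index
re-indexing hypothesis of `eventually_approxHasRasmussen_multiIndex_of_single` holds.
[cite: ManolescuMarengonSarkarWillis2023, Thm. 3.7, Thm. 3.3, Thm. 2.8 (proof) and Thm. 1.11] -/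
theorem eventually_approxHasRasmussen_multiIndex_of_eventually_antitone :
    eventually_approxHasRasmussen_multiIndex := by
  refine eventually_approxHasRasmussen_multiIndex_of_single fun {r} {K} j hK h0 hw ↦ ?_
  obtain ⟨s₀, k₀, h₀⟩ := hev hK h0 hw
  obtain ⟨s₁, k₁, h₁⟩ := exists_stable_beltTwist hev hK h0 hw (Pi.single j 1)
  obtain rfl : s₁ = s₀ := stable_single_eq hS hev hAev hK h0 hw j h₀ h₁
  refine ⟨max k₀ k₁, fun k hk s ↦ ?_⟩
  have hA1 := h₁ k ((le_max_right _ _).trans hk)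
  have hB := h₀ k ((le_max_left _ _).trans hk)
  exact ⟨fun h ↦ by rw [h.unique_of_hasRasmussenInvariant_unique hS hA1]; exact hB,
    fun h ↦ by rw [h.unique_of_hasRasmussenInvariant_unique hS hB]; exact hA1⟩

end EventuallyAntitone

/-- **Thm. 1.11 at level `0` for all admissible knots gives eventual (indeed level-wise)
antitonicity**: `D(k⃗)(σ_j ∘ K) = D(0⃗)(σ_j ∘ σ^k ∘ K)` and `D(k⃗)(K) = D(0⃗)(σ^k ∘ K)`, and `σ^k ∘ K`
is again admissible.  So `eventually_approxHasRasmussen_multiIndex_of_eventually_antitone`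
contains `eventually_approxHasRasmussen_multiIndex_of_antitone`.
[cite: ManolescuMarengonSarkarWillis2023, Thm. 1.11 and Thm. 2.8 (proof)] -/
theorem eventually_antitone_of_antitone
    (hA : ∀ {r : ℕ}
      {K : Metric.sphere (0 : EuclideanSpace ℝ (Fin 2)) 1 → EuclideanSpace ℝ (Fin 4)}
      (j : Fin r), IsModelKnot r K → IsNullHomologous r K → (∀ t, wC (K t) ≠ 0) → ∀ {s s' : ℤ},
        ApproxHasRasmussen r 0 (beltTwist r (Pi.single j 1) ∘ K) s →
          ApproxHasRasmussen r 0 K s' → s ≤ s')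
    {K : Metric.sphere (0 : EuclideanSpace ℝ (Fin 2)) 1 → EuclideanSpace ℝ (Fin 4)}
    (j : Fin r) (hK : IsModelKnot r K) (h0 : IsNullHomologous r K) (hw : ∀ t, wC (K t) ≠ 0) :
    ∃ k₁ : ℤ, ∀ k : ℤ, k₁ ≤ k → ∀ {s s' : ℤ},
      ApproxHasRasmussen r k (beltTwist r (Pi.single j 1) ∘ K) s →
        ApproxHasRasmussen r k K s' → s ≤ s' := by
  refine ⟨0, fun k _ ↦ ?_⟩
  intro s s' hs hs'
  have hcomm : (Pi.single j 1 + fun _ ↦ k : Fin r → ℤ) = (fun _ ↦ k) + Pi.single j 1 :=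
    add_comm _ _
  rw [approxHasRasmussen_iff_beltTwist_const_zero (hK.beltTwist_comp _).mem k,
    beltTwist_comp_beltTwist_comp hK.mem, hcomm, ← beltTwist_comp_beltTwist_comp hK.mem] at hs
  rw [approxHasRasmussen_iff_beltTwist_const_zero hK.mem k] at hs'
  exact hA j (hK.beltTwist_comp _) ((isNullHomologous_beltTwist_comp_iff K _).2 h0)
    (wC_beltTwist_comp_ne_zero hK hw _) hs hs'

/-- **The named fact from concordance invariance of `s`, the diagonal fact and eventual
antitonicity in one index.** [cite: ManolescuMarengonSarkarWillis2023, Thm. 3.7, Thm. 3.3 and Thm. 1.11] -/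
theorem eventually_approxHasRasmussen_multiIndex_of_eq_of_isConcordant_of_eventually_antitone
    (hci : HasRasmussenInvariant.eq_of_isConcordant) (hev : eventually_approxHasRasmussen)
    (hAev : ∀ {r : ℕ}
      {K : Metric.sphere (0 : EuclideanSpace ℝ (Fin 2)) 1 → EuclideanSpace ℝ (Fin 4)}
      (j : Fin r), IsModelKnot r K → IsNullHomologous r K → (∀ t, wC (K t) ≠ 0) →
        ∃ k₁ : ℤ, ∀ k : ℤ, k₁ ≤ k → ∀ {s s' : ℤ},
          ApproxHasRasmussen r k (beltTwist r (Pi.single j 1) ∘ K) s →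
            ApproxHasRasmussen r k K s' → s ≤ s') :
    eventually_approxHasRasmussen_multiIndex :=
  eventually_approxHasRasmussen_multiIndex_of_eventually_antitone
    (fun h h' ↦ HasRasmussenInvariant.unique_of_eq_of_isConcordant hci h h') hev hAev

/-! ## Over the diagonal fact and single-valuedness of `s`, the named fact IS eventual antitonicity

Conversely the named fact trivially gives `hAev` (eventually the two Rasmussen invariants agree).
So, modulo the two named facts `HasRasmussenInvariant.eq_of_isConcordant` (or any other source of
single-valuedness of `s` in `S³`) and `MMSW.eventually_approxHasRasmussen`, the named fact
`eventually_approxHasRasmussen_multiIndex` is EQUIVALENT to eventual antitonicity in one index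
along the diagonal: that one-sided eventual inequality is exactly what remains to be supplied
(by [MMSW] Thm. 1.11, or by the single-band increment of the stabilisation behind Thm. 3.7). -/

/-- The named fact gives eventual antitonicity in one index, given single-valuedness of `s` in
`S³`: eventually `s(D(k⃗)(σ_j ∘ K)) = s(D(k⃗)(K))`. [cite: ManolescuMarengonSarkarWillis2023, Thm. 3.7 and Thm. 3.3] -/
theorem eventually_antitone_of_multiIndex
    (hS : ∀ {K₃ : Knot} {s s' : ℤ}, K₃.HasRasmussenInvariant s → K₃.HasRasmussenInvariant s' → s = s')
    (hm : eventually_approxHasRasmussen_multiIndex)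
    {K : Metric.sphere (0 : EuclideanSpace ℝ (Fin 2)) 1 → EuclideanSpace ℝ (Fin 4)}
    (j : Fin r) (hK : IsModelKnot r K) (h0 : IsNullHomologous r K) (hw : ∀ t, wC (K t) ≠ 0) :
    ∃ k₁ : ℤ, ∀ k : ℤ, k₁ ≤ k → ∀ {s s' : ℤ},
      ApproxHasRasmussen r k (beltTwist r (Pi.single j 1) ∘ K) s →
        ApproxHasRasmussen r k K s' → s ≤ s' := by
  obtain ⟨k₀, hk⟩ := (eventually_approxHasRasmussen_multiIndex_iff.1 hm) hK h0 hw (Pi.single j 1)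
  refine ⟨k₀, fun k hkk ↦ ?_⟩
  intro s s' hs hs'
  exact (((hk k hkk s).1 hs).unique_of_hasRasmussenInvariant_unique hS hs').le

/-- **Modulo the diagonal fact and single-valuedness of `s` in `S³`, the named fact is equivalent
to eventual antitonicity in one index along the diagonal.**
[cite: ManolescuMarengonSarkarWillis2023, Thm. 3.7, Thm. 3.3 and Thm. 1.11] -/
theorem eventually_approxHasRasmussen_multiIndex_iff_eventually_antitone
    (hS : ∀ {K₃ : Knot} {s s' : ℤ}, K₃.HasRasmussenInvariant s → K₃.HasRasmussenInvariant s' → s = s')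
    (hev : eventually_approxHasRasmussen) :
    eventually_approxHasRasmussen_multiIndex ↔
      ∀ {r : ℕ}
        {K : Metric.sphere (0 : EuclideanSpace ℝ (Fin 2)) 1 → EuclideanSpace ℝ (Fin 4)}
        (j : Fin r), IsModelKnot r K → IsNullHomologous r K → (∀ t, wC (K t) ≠ 0) →
          ∃ k₁ : ℤ, ∀ k : ℤ, k₁ ≤ k → ∀ {s s' : ℤ},
            ApproxHasRasmussen r k (beltTwist r (Pi.single j 1) ∘ K) s →
              ApproxHasRasmussen r k K s' → s ≤ s' :=
  ⟨fun hm ↦ fun j hK h0 hw ↦ eventually_antitone_of_multiIndex hS hm j hK h0 hw,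
    fun hAev ↦ eventually_approxHasRasmussen_multiIndex_of_eventually_antitone hS hev hAev⟩

/-- The same equivalence over the two named facts `HasRasmussenInvariant.eq_of_isConcordant`
(Rasmussen (2010), Thm. 1) and `MMSW.eventually_approxHasRasmussen` ([MMSW] Thm. 1.4).
[cite: ManolescuMarengonSarkarWillis2023, Thm. 3.7, Thm. 3.3 and Thm. 1.11] -/
theorem eventually_approxHasRasmussen_multiIndex_iff_eventually_antitone_of_eq_of_isConcordant
    (hci : HasRasmussenInvariant.eq_of_isConcordant) (hev : eventually_approxHasRasmussen) :
    eventually_approxHasRasmussen_multiIndex ↔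
      ∀ {r : ℕ}
        {K : Metric.sphere (0 : EuclideanSpace ℝ (Fin 2)) 1 → EuclideanSpace ℝ (Fin 4)}
        (j : Fin r), IsModelKnot r K → IsNullHomologous r K → (∀ t, wC (K t) ≠ 0) →
          ∃ k₁ : ℤ, ∀ k : ℤ, k₁ ≤ k → ∀ {s s' : ℤ},
            ApproxHasRasmussen r k (beltTwist r (Pi.single j 1) ∘ K) s →
              ApproxHasRasmussen r k K s' → s ≤ s' :=
  eventually_approxHasRasmussen_multiIndex_iff_eventually_antitone
    (fun h h' ↦ HasRasmussenInvariant.unique_of_eq_of_isConcordant hci h h') hev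

/-! ## Constant multi-indices and one handle, over single-valuedness of `s`

The robust forms of `eventually_approxHasRasmussen_multiIndex_const` / `_one_left`
(`MMSWBeltTwistInvarianceProofs.lean`), with single-valuedness of `s` in `S³` (`hS`, e.g. from
`HasRasmussenInvariant.eq_of_isConcordant`) in place of `Knot.reidemeister`: for a constant
multi-index — in particular for `r = 1`, `M_1 ≅ S¹ × S²` — the diagonal fact alone suffices
(`D(k⃗)(σ^e ∘ K) = D(k⃗ + e⃗)(K)`, no cross-index input). -/

/-- **The fact for a constant multi-index `ε = (e, …, e)` over single-valuedness of `s`.**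
[cite: ManolescuMarengonSarkarWillis2023, Thm. 3.3 and Thm. 2.8 (proof)] -/
theorem eventually_approxHasRasmussen_multiIndex_const_of_unique
    (hS : ∀ {K₃ : Knot} {s s' : ℤ}, K₃.HasRasmussenInvariant s → K₃.HasRasmussenInvariant s' → s = s')
    (hev : eventually_approxHasRasmussen)
    {K : Metric.sphere (0 : EuclideanSpace ℝ (Fin 2)) 1 → EuclideanSpace ℝ (Fin 4)}
    (hK : IsModelKnot r K) (h0 : IsNullHomologous r K) (hw : ∀ t, wC (K t) ≠ 0) (e : ℤ) :
    ∃ k₀ : ℤ, ∀ k : ℤ, k₀ ≤ k → ∀ s : ℤ,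
      ApproxHasRasmussen r k (beltTwist r (fun _ ↦ e) ∘ K) s ↔ ApproxHasRasmussen r k K s := by
  obtain ⟨s₀, k₀, hk⟩ := hev hK h0 hw
  refine ⟨k₀ + |e|, fun k hkk s ↦ ?_⟩
  rw [approxHasRasmussen_beltTwist_const_comp_iff hK.mem]
  have hle : -|e| ≤ e := neg_abs_le e
  have h1 : ApproxHasRasmussen r (e + k) K s₀ := hk _ (by omega)
  have h2 : ApproxHasRasmussen r k K s₀ := hk _ (by have := abs_nonneg e; omega)
  exact ⟨fun h ↦ by rw [h.unique_of_hasRasmussenInvariant_unique hS h1]; exact h2,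
    fun h ↦ by rw [h.unique_of_hasRasmussenInvariant_unique hS h2]; exact h1⟩

/-- **The fact for `r = 1` (`M_1 ≅ S¹ × S²`) over single-valuedness of `s`**: every multi-index is
constant. [cite: ManolescuMarengonSarkarWillis2023, Thm. 3.3 and Thm. 2.8 (proof)] -/
theorem eventually_approxHasRasmussen_multiIndex_one_left_of_unique
    (hS : ∀ {K₃ : Knot} {s s' : ℤ}, K₃.HasRasmussenInvariant s → K₃.HasRasmussenInvariant s' → s = s')
    (hev : eventually_approxHasRasmussen)
    {K : Metric.sphere (0 : EuclideanSpace ℝ (Fin 2)) 1 → EuclideanSpace ℝ (Fin 4)}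
    (hK : IsModelKnot 1 K) (h0 : IsNullHomologous 1 K) (hw : ∀ t, wC (K t) ≠ 0) (ε : Fin 1 → ℤ) :
    ∃ k₀ : ℤ, ∀ k : ℤ, k₀ ≤ k → ∀ s : ℤ,
      ApproxHasRasmussen 1 k (beltTwist 1 ε ∘ K) s ↔ ApproxHasRasmussen 1 k K s := by
  have hε : ε = fun _ ↦ ε 0 := funext fun j ↦ by rw [Subsingleton.elim j 0]
  rw [hε]
  exact eventually_approxHasRasmussen_multiIndex_const_of_unique hS hev hK h0 hw (ε 0)

/-- **The fact for `r = 1` from the two named facts `HasRasmussenInvariant.eq_of_isConcordant`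
and `MMSW.eventually_approxHasRasmussen`** (no cross-index input in `S¹ × S²`).
[cite: ManolescuMarengonSarkarWillis2023, Thm. 3.3 and Thm. 2.8 (proof)] -/
theorem eventually_approxHasRasmussen_multiIndex_one_left_of_eq_of_isConcordant
    (hci : HasRasmussenInvariant.eq_of_isConcordant) (hev : eventually_approxHasRasmussen)
    {K : Metric.sphere (0 : EuclideanSpace ℝ (Fin 2)) 1 → EuclideanSpace ℝ (Fin 4)}
    (hK : IsModelKnot 1 K) (h0 : IsNullHomologous 1 K) (hw : ∀ t, wC (K t) ≠ 0) (ε : Fin 1 → ℤ) :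
    ∃ k₀ : ℤ, ∀ k : ℤ, k₀ ≤ k → ∀ s : ℤ,
      ApproxHasRasmussen 1 k (beltTwist 1 ε ∘ K) s ↔ ApproxHasRasmussen 1 k K s :=
  eventually_approxHasRasmussen_multiIndex_one_left_of_unique
    (fun h h' ↦ HasRasmussenInvariant.unique_of_eq_of_isConcordant hci h h') hev hK h0 hw ε

end MMSW

end Literature.Topology.FourManifolds

end
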